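import Literature.AnabelianGeometry.Anabelioids.SlimFiniteEtale
import Mathlib.CategoryTheory.Galois.Topology
import Mathlib.CategoryTheory.Adjunction.Mates
import Mathlib.CategoryTheory.Comma.Over.Pullback
import Mathlib.CategoryTheory.Conj
import Mathlib.CategoryTheory.HomCongr
import Mathlib.Topology.Algebra.MulAction
import HarnessLib

/-!
# Slim anabelioids: proof of [GeoAn] Proposition 1.2.5 (i)

Mochizuki, *The geometry of anabelioids*, Publ. RIMS **40** (2004), §1.2, Proposition 1.2.5 (i),
author's manuscript p. 18 [cite: MochizukiGeoAn2004, Prop. 1.2.5(i) p.18]: "The pull-back and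
extension functors associated to a finite étale morphism between slim anabelioids are rigid."
The statement file `Literature.AnabelianGeometry.Anabelioids.SlimFiniteEtale` records this as the
named fact `proposition_1_2_5_i`; this proof-only companion discharges it AS TYPED
(`proposition_1_2_5_i_holds`).

Proof.  A finite étale `P : X ⥤ Y` is `P ≅ i_S^* ⋙ α` with `i_S^* = Over.star S : X ⥤ X_S` and
`α : X_S ⥤ Y` an equivalence.  Rigidity (= "the group of automorphisms of the functor is trivial")
is invariant under isomorphism of functors, under post-composition with an equivalence, and under
passage to an adjoint (mates: Mathlib's `conjugateIsoEquiv`); so both assertions reduce to the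
rigidity of the extension functor `(S_! =) Over.forget S : X_S ⥤ X` for a SLIM connected anabelioid
`X` (`forget_rigid`), which we prove with a basepoint `β = F` of `X` (π₁ = `Aut F`, slim):
an automorphism `b` of `Over.forget S` has components `β_B : B × S ≅ B × S` on the objects
`(B × S → S)`, natural in `B`; for a point `s` of `F(S)` the maps
`c^s_B : F(B) → F(B)`, `x ↦ pr₁ F(β_B)(x, s)` form an automorphism `c^s` of the fibre functor
`F` which commutes with the (open) stabiliser of `s` in `π₁(X, β)`; slimness forces `c^s = 1`,
and evaluating naturality of `b` on the graph `(1, u) : (B, u) → (B × S, pr₂)` of an arbitrary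
object `u : B → S` over `S` gives `F(b_{(B,u)}) = id`, hence `b = 1` by faithfulness of `F`.
(Only the slimness of `X` is used.)  Proof-only file: no definitions.
-/

namespace Literature.AnabelianGeometry.Anabelioids

open CategoryTheory CategoryTheory.Limits CategoryTheory.PreGaloisCategory
open Literature.AlgebraicGeometry.Frobenioids (IsRigidFunctor IsSlimGroup)

universe v₁ v₂ u₁ u₂

section

variable {X : Type u₁} [Category.{v₁} X] [GaloisCategory X]

/-- Points of the fibre of a binary product are determined by their two projections. [folklore] -/
private theorem fiber_prod_ext (F : X ⥤ FintypeCat.{v₁}) [FiberFunctor F] {B S : X}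
    {p q : F.obj (B ⨯ S)} (h₁ : F.map prod.fst p = F.map prod.fst q)
    (h₂ : F.map prod.snd p = F.map prod.snd q) : p = q := by
  have hp : ∀ r : F.obj (B ⨯ S),
      fiberBinaryProductEquiv F B S r = (F.map prod.fst r, F.map prod.snd r) := fun r => by
    obtain ⟨⟨a, c⟩, rfl⟩ := (fiberBinaryProductEquiv F B S).symm.surjective r
    simp
  apply (fiberBinaryProductEquiv F B S).injective
  rw [hp, hp, h₁, h₂]

/-- **Rigidity of the extension functor** `X_S → X` of a slim connected anabelioid ([GeoAn]
Prop. 1.2.5 (i), the core case): every automorphism of `Over.forget S : Over S ⥤ X` is the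
identity. [cite: MochizukiGeoAn2004, Prop. 1.2.5(i) p.18] -/
theorem forget_rigid (hX : IsSlim X) (S : X) (b : Over.forget S ≅ Over.forget S) :
    b = Iso.refl _ := by
  classical
  obtain ⟨F, ⟨hF⟩⟩ := @GaloisCategory.hasFiberFunctor X _ _
  have hslim : IsSlimGroup (Aut F) := hX.isSlimGroup F
  -- the components of `b` at the objects `(B × S → S)`, with clean types
  let β : ∀ B : X, (B ⨯ S ⟶ B ⨯ S) := fun B => b.hom.app (Over.mk (prod.snd : B ⨯ S ⟶ S))
  have hβnat : ∀ {B B' : X} (k : B ⟶ B'),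
      prod.map k (𝟙 S) ≫ β B' = β B ≫ prod.map k (𝟙 S) := fun {B B'} k =>
    b.hom.naturality (Over.homMk (prod.map k (𝟙 S))
      ((prod.map_snd k (𝟙 S)).trans (Category.comp_id _)) :
      Over.mk (prod.snd : B ⨯ S ⟶ S) ⟶ Over.mk (prod.snd : B' ⨯ S ⟶ S))
  have hβnat' : ∀ {B B' : X} (k : B ⟶ B') (y : F.obj (B ⨯ S)),
      F.map (β B') (F.map (prod.map k (𝟙 S)) y) = F.map (prod.map k (𝟙 S)) (F.map (β B) y) :=
    fun k y => by
    have h := congrArg (fun φ => F.map φ y) (hβnat k)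
    simpa only [F.map_comp, FintypeCat.comp_apply] using h
  have hfst : ∀ {B B' : X} (k : B ⟶ B') (y : F.obj (B ⨯ S)),
      F.map prod.fst (F.map (prod.map k (𝟙 S)) y) = F.map k (F.map prod.fst y) := fun k y => by
    have h := congrArg (fun φ => F.map φ y) (prod.map_fst k (𝟙 S))
    simpa only [F.map_comp, FintypeCat.comp_apply] using h
  have hsnd : ∀ {B B' : X} (k : B ⟶ B') (y : F.obj (B ⨯ S)),
      F.map prod.snd (F.map (prod.map k (𝟙 S)) y) = F.map prod.snd y := fun k y => by
    have h := congrArg (fun φ => F.map φ y) (prod.map_snd k (𝟙 S))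
    simpa only [F.map_comp, FintypeCat.comp_apply, F.map_id, FintypeCat.id_apply] using h
  -- `F.map (prod.map k 1)` acts as `(x, s) ↦ (F.map k x, s)` on fibres
  have hpair : ∀ {B B' : X} (k : B ⟶ B') (x : F.obj B) (s : F.obj S),
      F.map (prod.map k (𝟙 S)) ((fiberBinaryProductEquiv F B S).symm (x, s)) =
        (fiberBinaryProductEquiv F B' S).symm (F.map k x, s) := fun k x s => by
    apply fiber_prod_ext F
    · rw [hfst, fiberBinaryProductEquiv_symm_fst_apply, fiberBinaryProductEquiv_symm_fst_apply]
    · rw [hsnd, fiberBinaryProductEquiv_symm_snd_apply, fiberBinaryProductEquiv_symm_snd_apply]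
  -- KEY: `pr₁ F(β_B)(x, s) = x`
  have key : ∀ (s : F.obj S) (B : X) (x : F.obj B),
      F.map prod.fst (F.map (β B) ((fiberBinaryProductEquiv F B S).symm (x, s))) = x := by
    intro s
    -- the natural endomorphism `c^s` of `F`
    let η : F ⟶ F :=
      { app := fun B => FintypeCat.homMk fun x =>
          F.map prod.fst (F.map (β B) ((fiberBinaryProductEquiv F B S).symm (x, s)))
        naturality := fun B B' k => by
          ext x
          simp only [FintypeCat.comp_apply, FintypeCat.homMk_apply]
          rw [← hpair k x s, hβnat' k, hfst k] }
    haveI : IsIso η := FibreFunctor.end_isIso F η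
    let c : Aut F := asIso η
    -- `c^s` commutes with the stabiliser of `s` in `π₁(X, F)`
    have hc : c ∈ Subgroup.centralizer
        ((MulAction.stabilizer (Aut F) s : Subgroup (Aut F)) : Set (Aut F)) := by
      rw [Subgroup.mem_centralizer_iff]
      intro h hh
      have hs : h.hom.app S s = s := by
        rw [SetLike.mem_coe, MulAction.mem_stabilizer_iff, mulAction_def] at hh
        exact hh
      have h1 : ∀ (B : X) (x : F.obj B),
          h.hom.app (B ⨯ S) ((fiberBinaryProductEquiv F B S).symm (x, s)) =
            (fiberBinaryProductEquiv F B S).symm (h.hom.app B x, s) := fun B x => by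
        apply fiber_prod_ext F
        · rw [← FunctorToFintypeCat.naturality, fiberBinaryProductEquiv_symm_fst_apply,
            fiberBinaryProductEquiv_symm_fst_apply]
        · rw [← FunctorToFintypeCat.naturality, fiberBinaryProductEquiv_symm_snd_apply,
            fiberBinaryProductEquiv_symm_snd_apply, hs]
      apply Aut.ext
      simp only [Aut.Aut_mul_def, Iso.trans_hom, c, asIso_hom]
      ext B x
      simp only [NatTrans.comp_app, FintypeCat.comp_apply, η, FintypeCat.homMk_apply]
      rw [FunctorToFintypeCat.naturality, FunctorToFintypeCat.naturality, h1]
    -- slimness: the stabiliser is open, so its centraliser is trivial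
    have hopen : IsOpen ((MulAction.stabilizer (Aut F) s : Subgroup (Aut F)) : Set (Aut F)) :=
      stabilizer_isOpen (Aut F) s
    have hc1 : c = 1 := by
      have h0 := hslim.centralizer_eq_bot _ hopen
      rw [h0] at hc
      exact Subgroup.mem_bot.mp hc
    intro B x
    have h2 : c.hom.app B x = x := by
      rw [hc1]
      rfl
    exact h2
  -- conclusion: every component of `b` is the identity (test on the graph `(1, u)` of `u`)
  have final : ∀ (U : Over S) (x : F.obj U.left),
      F.map (b.hom.app U : U.left ⟶ U.left) x = x := by
    intro U x
    let bU : U.left ⟶ U.left := b.hom.app U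
    let gr : U.left ⟶ U.left ⨯ S := prod.lift (𝟙 U.left) (U.hom : U.left ⟶ S)
    change F.map bU x = x
    have nat : gr ≫ β U.left = bU ≫ gr :=
      b.hom.naturality (Over.homMk (prod.lift (𝟙 U.left) (U.hom : U.left ⟶ S))
        (prod.lift_snd _ _) : U ⟶ Over.mk (prod.snd : U.left ⨯ S ⟶ S))
    have e1 : F.map (β U.left) (F.map gr x) = F.map gr (F.map bU x) := by
      have h := congrArg (fun φ => F.map φ x) nat
      simpa only [F.map_comp, FintypeCat.comp_apply] using h
    have e2 : ∀ y : F.obj U.left,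
        F.map gr y = (fiberBinaryProductEquiv F U.left S).symm (y, F.map (U.hom : U.left ⟶ S) y) :=
      fun y => by
      apply fiber_prod_ext F
      · rw [← FintypeCat.comp_apply, ← F.map_comp, prod.lift_fst,
          fiberBinaryProductEquiv_symm_fst_apply, F.map_id, FintypeCat.id_apply]
      · rw [← FintypeCat.comp_apply, ← F.map_comp, prod.lift_snd,
          fiberBinaryProductEquiv_symm_snd_apply]
    have e3 : ∀ y : F.obj U.left, F.map prod.fst (F.map gr y) = y := fun y => by
      have h := congrArg (fun φ => F.map φ y) (prod.lift_fst (𝟙 U.left) (U.hom : U.left ⟶ S))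
      simpa only [F.map_comp, FintypeCat.comp_apply, F.map_id, FintypeCat.id_apply] using h
    have e4 := congrArg (F.map prod.fst) e1
    rw [e2 x, key, e3] at e4
    exact e4.symm
  refine Iso.ext (NatTrans.ext (funext fun U => ?_))
  apply F.map_injective
  ext x
  simp only [Iso.refl_hom, NatTrans.id_app, F.map_id, FintypeCat.id_apply]
  exact final U x

end

/-- **[GeoAn] Proposition 1.2.5 (i)** (p. 18): for slim connected anabelioids `X`, `Y` and a finite
étale `P : X ⥤ Y` (i.e. `P ≅ i_S^* ⋙ α`, `α : X_S ⥲ Y`), the pull-back functor `P` and any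
extension functor `L ⊣ P` are rigid — the named fact `proposition_1_2_5_i` HOLDS.  Reductions:
`Aut(L) ≃ Aut(P)` (mates), `Aut(P) ≃ Aut(i_S^* ⋙ α) ≃ Aut(i_S^*) ≃ Aut(S_!)` (conjugation,
whiskering by an equivalence, mates for `S_! ⊣ i_S^*`), and `Aut(S_!) = 1` by `forget_rigid`.
[cite: MochizukiGeoAn2004, Prop. 1.2.5(i) p.18] -/
theorem proposition_1_2_5_i_holds : proposition_1_2_5_i.{v₁, v₂, u₁, u₂} := by
  intro X _ Y _ _ _ hX _ P hP
  obtain ⟨S, α, hα, ⟨e⟩⟩ := hP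
  -- `Aut(S_!)` is trivial, hence so is `Aut(i_S^*)` (mates) and `Aut(i_S^* ⋙ α)` (whiskering)
  haveI h0 : Subsingleton (Over.forget S ≅ Over.forget S) :=
    ⟨fun a b => (forget_rigid hX S a).trans (forget_rigid hX S b).symm⟩
  haveI h1 : Subsingleton (Over.star S ≅ Over.star S) :=
    (conjugateIsoEquiv (Over.forgetAdjStar S) (Over.forgetAdjStar S)).symm.subsingleton
  haveI h2 : Subsingleton (Over.star S ⋙ α ≅ Over.star S ⋙ α) :=
    ((Functor.FullyFaithful.ofFullyFaithful α).whiskeringRight X).isoEquiv.symm.subsingleton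
  haveI h3 : Subsingleton (P ≅ P) := (Iso.isoCongr e e).subsingleton
  refine ⟨fun a => Subsingleton.elim _ _, fun L adj a => ?_⟩
  haveI : Subsingleton (L ≅ L) := (conjugateIsoEquiv adj adj).subsingleton
  exact Subsingleton.elim _ _

end Literature.AnabelianGeometry.Anabelioids
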